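import Literature.AlgebraicGeometry.Resolution.LogRegularBaseChange
import Mathlib.RingTheory.RegularLocalRing.Polynomial
import Mathlib.RingTheory.KrullDimension.Polynomial
import Mathlib.RingTheory.Ideal.GoingDown
import HarnessLib

/-!
# The local rings of the torus fibre: `(A[X₁,…,X_g])_𝔮` over a Noetherian local ring `A`

`Literature/AlgebraicGeometry/Resolution/LogRegularPolynomialBase.lean`. In K. Kato, *Toric
singularities*, Amer. J. Math. 116 (1994), (10.3), the points of the refined chart over `x ∈ X`
whose face coordinates are units live over the local rings `A₁ = (A[S₁^{±1},…,S_g^{±1}])_𝔮`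
(`𝔮 ∩ A = 𝔪_A`) — localizations of the POLYNOMIAL ring `A[S]` at primes over `𝔪_A`. This file
supplies the hypotheses of `LogRegularBaseChange.lean` for these base changes: `A → A₁` is local,
`𝔪_{A₁} = 𝔪_A A₁ + (t″₁,…,t″_h)` with `h = ht 𝔮̄` (`𝔮̄` the image of `𝔮` in `k[S]`, whose local
ring is regular), and `dim A₁ = dim A + h` (Mathlib's dimension formula for the flat extension
`A → A[S]`, Stacks 00ON).

* `localization_mvPolynomial_baseChange` — the three facts;
* `isRegularLocalRing_localization_closedPoint_torusFibre` — Kato (10.3) at the origin of the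
  refined (absorbed, twisted) chart over `(A[S])_𝔮`.

References: [Kato1994] K. Kato, Toric singularities, Amer. J. Math. 116 (1994), (10.3);
[Matsumura1987] H. Matsumura, Commutative Ring Theory, Thm. 15.1.
-/

noncomputable section

open IsLocalRing Literature.RingTheory.MvPowerSeries
  Literature.RingTheory.MvPowerSeries.monoidPowerSeries

namespace Literature.AlgebraicGeometry.Resolution

namespace LogRegularCompleteStructure

universe u

variable {A : Type u} [CommRing A] [IsLocalRing A] [IsNoetherianRing A] {g : ℕ}

set_option maxHeartbeats 800000 in
/-- **The torus-fibre base change.** Let `A` be a Noetherian local ring and `𝔮` a prime of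
`A[X₁,…,X_g]` with `𝔮 ∩ A = 𝔪_A`, `A₁ = A[X]_𝔮`. Then `A → A₁` is local, and there are
`t″₁,…,t″_h ∈ 𝔪_{A₁}` with `𝔪_{A₁} = 𝔪_A A₁ + (t″)` and `dim A + h ≤ dim A₁` (indeed `=`; here
`h = ht 𝔮̄ = dim k[X]_𝔮̄`, a regular local ring). [cite: Kato1994, (10.3)]
[cite: Matsumura1987, Thm. 15.1] -/
theorem localization_mvPolynomial_baseChange (𝔮 : Ideal (MvPolynomial (Fin g) A)) [𝔮.IsPrime]
    (h𝔮 : 𝔮.comap (MvPolynomial.C : A →+* MvPolynomial (Fin g) A) = maximalIdeal A) :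
    IsLocalHom (algebraMap A (Localization.AtPrime 𝔮)) ∧
      ∃ (h : ℕ) (t'' : Fin h → Localization.AtPrime 𝔮),
        (∀ k, t'' k ∈ maximalIdeal (Localization.AtPrime 𝔮)) ∧
        maximalIdeal (Localization.AtPrime 𝔮) ≤
          (maximalIdeal A).map (algebraMap A (Localization.AtPrime 𝔮)) ⊔ Ideal.span (Set.range t'') ∧
        ringKrullDim A + h ≤ ringKrullDim (Localization.AtPrime 𝔮) := by
  classical
  set L := MvPolynomial (Fin g) A with hL
  set A₁ := Localization.AtPrime 𝔮 with hA₁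
  have halgL : algebraMap A L = MvPolynomial.C := MvPolynomial.algebraMap_eq A (Fin g)
  have halg : algebraMap A A₁ = (algebraMap L A₁).comp (algebraMap A L) :=
    IsScalarTower.algebraMap_eq A L A₁
  haveI hlies : 𝔮.LiesOver (maximalIdeal A) := ⟨by rw [Ideal.under_def, halgL, h𝔮]⟩
  -- `A → A₁` is local
  have hmA : (maximalIdeal A).map (algebraMap A A₁) ≤ maximalIdeal A₁ := by
    rw [halg, ← Ideal.map_map, ← Localization.AtPrime.map_eq_maximalIdeal]
    refine Ideal.map_mono ?_
    rw [Ideal.map_le_iff_le_comap, halgL, h𝔮]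
  have hloc : IsLocalHom (algebraMap A A₁) := by
    refine ⟨fun a ha => ?_⟩
    by_contra hna
    exact ((mem_maximalIdeal _).1 (hmA (Ideal.mem_map_of_mem _
      ((mem_maximalIdeal _).2 (mem_nonunits_iff.2 hna))))) ha
  refine ⟨hloc, ?_⟩
  -- the fibre ring `L' = L/𝔪L ≅ k[X]` and the prime `𝔮'`
  set L' := L ⧸ (maximalIdeal A).map (algebraMap A L) with hL'
  let e : MvPolynomial (Fin g) (ResidueField A) ≃ₐ[A] L' :=
    MvPolynomial.quotientEquivQuotientMvPolynomial (maximalIdeal A)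
  haveI : IsRegularRing L' := IsRegularRing.of_ringEquiv e.toRingEquiv
  haveI : IsDomain L' := e.toRingEquiv.symm.injective.isDomain e.toRingEquiv.symm.toRingHom
  have hker : RingHom.ker (Ideal.Quotient.mk ((maximalIdeal A).map (algebraMap A L))) ≤ 𝔮 := by
    rw [Ideal.mk_ker, Ideal.map_le_iff_le_comap, halgL, h𝔮]
  set 𝔮' : Ideal L' := 𝔮.map (Ideal.Quotient.mk _) with h𝔮'
  haveI : 𝔮'.IsPrime := Ideal.map_isPrime_of_surjective Ideal.Quotient.mk_surjective hker
  have hcomap : 𝔮'.comap (Ideal.Quotient.mk _) = 𝔮 := by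
    rw [h𝔮', Ideal.comap_map_of_surjective _ Ideal.Quotient.mk_surjective]
    exact sup_eq_left.2 fun x hx => hker hx
  set R' := Localization.AtPrime 𝔮' with hR'
  haveI hreg : IsRegularLocalRing R' := inferInstance
  -- `h` generators of `𝔪_{R'}`, numerators in `𝔮'`, lifted to `𝔮`
  have hfg : (maximalIdeal R').FG := (maximalIdeal R').fg_of_isNoetherianRing
  obtain ⟨s, hscard, hsspan⟩ := Submodule.FG.exists_span_finset_card_eq_spanFinrank hfg
  have hnum : ∀ y : R', y ∈ maximalIdeal R' → ∃ n : L', n ∈ 𝔮' ∧ ∃ d : 𝔮'.primeCompl,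
      y * algebraMap L' R' d = algebraMap L' R' n := by
    intro y hy
    obtain ⟨⟨n, d⟩, hnd⟩ := IsLocalization.surj 𝔮'.primeCompl y
    refine ⟨n, ?_, d, hnd⟩
    have h1 : algebraMap L' R' n ∈ maximalIdeal R' := by
      rw [← hnd]; exact Ideal.mul_mem_right _ _ hy
    have hu := Localization.AtPrime.under_maximalIdeal (I := 𝔮')
    rw [← hu]
    exact h1
  choose num hnum𝔮 den hden using hnum
  have hlift : ∀ n : L', n ∈ 𝔮' → ∃ ℓ : L, ℓ ∈ 𝔮 ∧ Ideal.Quotient.mk _ ℓ = n := by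
    intro n hn
    obtain ⟨ℓ, rfl⟩ := Ideal.Quotient.mk_surjective n
    exact ⟨ℓ, by rw [← hcomap]; exact hn, rfl⟩
  choose lift hlift𝔮 hliftmk using hlift
  let ys : Fin s.card → R' := fun i => (s.equivFin.symm i : R')
  have hys : ∀ i, ys i ∈ maximalIdeal R' := fun i => by
    rw [← hsspan]; exact Submodule.subset_span (s.equivFin.symm i).2
  let ℓs : Fin s.card → L := fun i => lift (num (ys i) (hys i)) (hnum𝔮 (ys i) (hys i))
  have hℓs𝔮 : ∀ i, ℓs i ∈ 𝔮 := fun i => hlift𝔮 _ _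
  have hℓsmk : ∀ i, Ideal.Quotient.mk _ (ℓs i) = num (ys i) (hys i) := fun i => hliftmk _ _
  refine ⟨s.card, fun i => algebraMap L A₁ (ℓs i), fun i => ?_, ?_, ?_⟩
  · rw [← Localization.AtPrime.map_eq_maximalIdeal]
    exact Ideal.mem_map_of_mem _ (hℓs𝔮 i)
  · -- `𝔪_{A₁} ≤ 𝔪_A A₁ + (t'')`
    rw [← Localization.AtPrime.map_eq_maximalIdeal, Ideal.map_le_iff_le_comap]
    intro ℓ hℓ
    rw [Ideal.mem_comap]
    -- in `R'`: the numerators generate the maximal ideal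
    have hJ : maximalIdeal R' ≤ (Ideal.span (Set.range fun i => num (ys i) (hys i))).map
        (algebraMap L' R') := by
      rw [← hsspan]
      refine Submodule.span_le.2 fun y hy => ?_
      have hi : y = ys (s.equivFin ⟨y, hy⟩) := by simp [ys]
      rw [SetLike.mem_coe, hi]
      set i := s.equivFin ⟨y, hy⟩
      have hd : IsUnit (algebraMap L' R' (den (ys i) (hys i) : L')) :=
        IsLocalization.map_units R' (den (ys i) (hys i))
      have heq : ys i = algebraMap L' R' (num (ys i) (hys i)) * ↑(hd.unit⁻¹) := by
        rw [← hden (ys i) (hys i), mul_assoc, IsUnit.mul_val_inv, mul_one]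
      rw [heq]
      exact Ideal.mul_mem_right _ _ (Ideal.mem_map_of_mem _ (Ideal.subset_span ⟨i, rfl⟩))
    have h1 : algebraMap L' R' (Ideal.Quotient.mk _ ℓ) ∈ maximalIdeal R' := by
      rw [← Localization.AtPrime.map_eq_maximalIdeal]
      exact Ideal.mem_map_of_mem _ (Ideal.mem_map_of_mem _ hℓ)
    obtain ⟨⟨⟨a, ha⟩, d⟩, had⟩ := (IsLocalization.mem_map_algebraMap_iff 𝔮'.primeCompl R').1 (hJ h1)
    simp only at had
    -- `mk ℓ * d = a` in the domain `L'`
    have hinj : Function.Injective (algebraMap L' R') :=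
      IsLocalization.injective R' 𝔮'.primeCompl_le_nonZeroDivisors
    have had' : Ideal.Quotient.mk _ ℓ * (d : L') = a := hinj (by rw [map_mul, had])
    -- lift `a` and `d`
    have hmapspan : (Ideal.span (Set.range ℓs)).map
        (Ideal.Quotient.mk ((maximalIdeal A).map (algebraMap A L))) =
        Ideal.span (Set.range fun i => num (ys i) (hys i)) := by
      have hfun : (⇑(Ideal.Quotient.mk ((maximalIdeal A).map (algebraMap A L))) ∘ ℓs) =
          fun i => num (ys i) (hys i) := funext fun i => hℓsmk i
      rw [Ideal.map_span, ← Set.range_comp, hfun]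
    have ha' : a ∈ (Ideal.span (Set.range ℓs)).map
        (Ideal.Quotient.mk ((maximalIdeal A).map (algebraMap A L))) := by
      rw [hmapspan]; exact ha
    obtain ⟨α, hα, hαa⟩ := (Ideal.mem_map_iff_of_surjective _ Ideal.Quotient.mk_surjective).1 ha'
    obtain ⟨δ, hδ⟩ := Ideal.Quotient.mk_surjective (d : L')
    have hδ𝔮 : δ ∉ 𝔮 := by
      intro hδ𝔮
      apply d.2
      show (d : L') ∈ 𝔮'
      rw [← hδ]; exact Ideal.mem_map_of_mem _ hδ𝔮
    have hm : ℓ * δ - α ∈ (maximalIdeal A).map (algebraMap A L) := by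
      rw [← Ideal.Quotient.eq_zero_iff_mem, map_sub, map_mul, hδ, hαa, had', sub_self]
    -- conclude in `A₁`
    have hδu : IsUnit (algebraMap L A₁ δ) := IsLocalization.map_units A₁ ⟨δ, show δ ∈ 𝔮.primeCompl from hδ𝔮⟩
    have hℓeq : algebraMap L A₁ ℓ =
        (algebraMap L A₁ α + algebraMap L A₁ (ℓ * δ - α)) * ↑(hδu.unit⁻¹) := by
      rw [← map_add, add_sub_cancel, map_mul, mul_assoc, IsUnit.mul_val_inv, mul_one]
    rw [hℓeq]
    refine Ideal.mul_mem_right _ _ (Ideal.add_mem _ ?_ ?_)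
    · refine Ideal.mem_sup_right ?_
      have : (Ideal.span (Set.range ℓs)).map (algebraMap L A₁) = Ideal.span (Set.range fun i =>
          algebraMap L A₁ (ℓs i)) := by rw [Ideal.map_span, ← Set.range_comp]; rfl
      rw [← this]
      exact Ideal.mem_map_of_mem _ hα
    · refine Ideal.mem_sup_left ?_
      rw [halg, ← Ideal.map_map]
      exact Ideal.mem_map_of_mem _ hm
  · -- dimensions: `dim A₁ = ht 𝔮 = ht 𝔪_A + ht 𝔮' = dim A + h`
    have hdimA₁ : ringKrullDim A₁ = 𝔮.height := IsLocalization.AtPrime.ringKrullDim_eq_height 𝔮 A₁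
    have hflat : Module.Flat A L := inferInstance
    have hformula := Ideal.height_eq_height_add_of_liesOver_of_hasGoingDown (maximalIdeal A) 𝔮
    have hR'dim : ringKrullDim R' = 𝔮'.height := IsLocalization.AtPrime.ringKrullDim_eq_height 𝔮' R'
    have hspan : ((maximalIdeal R').spanFinrank : WithBot ℕ∞) = ringKrullDim R' :=
      (isRegularLocalRing_iff R').mp hreg
    have hh : (s.card : WithBot ℕ∞) = 𝔮'.height := by rw [hscard, hspan, hR'dim]
    rw [hdimA₁, hformula, ← IsLocalRing.maximalIdeal_height_eq_ringKrullDim]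
    have : (𝔮.map (Ideal.Quotient.mk (Ideal.map (algebraMap A L) (maximalIdeal A)))).height =
        𝔮'.height := rfl
    rw [this]
    have hh' : ((s.card : ℕ∞) : WithBot ℕ∞) = ((𝔮'.height : ℕ∞) : WithBot ℕ∞) := by
      exact_mod_cast hh
    have hh'' : (s.card : ℕ∞) = 𝔮'.height := by exact_mod_cast hh'
    rw [← hh'']
    exact le_of_eq (by push_cast; rfl)

/-- **Kato 1994, (10.3) at the points of the torus fibre.** Let `A` be a Noetherian local ring
with d-form chart data (`φ : P → A`, `t`, `𝔪_A = (φ(P ∖ 0)) + (t)`, `rank P + d ≤ dim A`),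
`𝔮` a prime of `A[X₁,…,X_g]` over `𝔪_A` with local ring `A₁ = A[X]_𝔮`, `u : P → A₁ˣ`
multiplicative, `c : P → ℕ^N` a refinement. Then for suitable `t″₁,…,t″_h ∈ 𝔪_{A₁}`
(`h = dim A₁ − dim A`) the refined chart of the absorbed twisted chart over `A₁` is a regular
local ring at its closed point. [cite: Kato1994, (10.3)] -/
theorem isRegularLocalRing_localization_closedPoint_torusFibre
    {M N d : ℕ} {P : AddSubmonoid (Fin M →₀ ℕ)} {φ : (Fin M →₀ ℕ) → A}
    (𝔮 : Ideal (MvPolynomial (Fin g) A)) [𝔮.IsPrime]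
    (h𝔮 : 𝔮.comap (MvPolynomial.C : A →+* MvPolynomial (Fin g) A) = maximalIdeal A)
    {u : (Fin M →₀ ℕ) → (Localization.AtPrime 𝔮)ˣ} {t : Fin d → A}
    {c : (Fin M →₀ ℕ) → (Fin N →₀ ℕ)} (hP : P.FG)
    (hφ0 : φ 0 = 1) (hφadd : ∀ a ∈ P, ∀ b ∈ P, φ (a + b) = φ a * φ b)
    (hφm : ∀ p ∈ P, p ≠ 0 → φ p ∈ maximalIdeal A) (ht : ∀ k, t k ∈ maximalIdeal A)
    (hgen : maximalIdeal A ≤ Ideal.span (φ '' {p | p ∈ P ∧ p ≠ 0}) ⊔ Ideal.span (Set.range t))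
    (hdim : ((rank P + d : ℕ) : WithBot ℕ∞) ≤ ringKrullDim A)
    (hu0 : u 0 = 1) (hu : ∀ a ∈ P, ∀ b ∈ P, u (a + b) = u a * u b)
    (hc0 : c 0 = 0) (hadd : ∀ a ∈ P, ∀ b ∈ P, c (a + b) = c a + c b)
    (hc : ∀ p ∈ P, p ≠ 0 → c p ≠ 0)
    (hfin : ∀ e : Fin N →₀ ℕ, {p : Fin M →₀ ℕ | p ∈ P ∧ c p = e}.Finite) :
    ∃ (h : ℕ) (t'' : Fin h → Localization.AtPrime 𝔮) (ht'' : ∀ k, t'' k ∈ maximalIdeal _)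
      (hloc : IsLocalHom (algebraMap A (Localization.AtPrime 𝔮))),
      letI := hloc
      letI := isMaximal_closedPoint (P := absorbMonoid P (d + h))
        (absorbChart_zero (twistChart_zero (algebraMap A (Localization.AtPrime 𝔮)) hφ0 hu0)
          (Fin.append (algebraMap A (Localization.AtPrime 𝔮) ∘ t) t''))
        (absorbChart_mem_maximalIdeal
          (twistChart_mem_maximalIdeal (algebraMap A (Localization.AtPrime 𝔮)) hφm)
          (t := Fin.append (algebraMap A (Localization.AtPrime 𝔮) ∘ t) t'') (fun k => by
            induction k using Fin.addCases with
            | left k => rw [Fin.append_left]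
                        exact (mem_maximalIdeal _).2 (map_nonunit (algebraMap A _) _
                          ((mem_maximalIdeal _).1 (ht k)))
            | right k => rw [Fin.append_right]; exact ht'' k))
        (absorbMap_zero (d := d + h) hc0) (absorbMap_ne_zero hc)
      IsRegularLocalRing (Localization.AtPrime (closedPoint
        (absorbChart (twistChart (algebraMap A (Localization.AtPrime 𝔮)) φ u)
          (Fin.append (algebraMap A (Localization.AtPrime 𝔮) ∘ t) t''))
        (absorbMap c) (absorbMonoid P (d + h))
        (absorbChart_zero (twistChart_zero (algebraMap A (Localization.AtPrime 𝔮)) hφ0 hu0)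
          (Fin.append (algebraMap A (Localization.AtPrime 𝔮) ∘ t) t''))
        (absorbChart_mem_maximalIdeal
          (twistChart_mem_maximalIdeal (algebraMap A (Localization.AtPrime 𝔮)) hφm)
          (t := Fin.append (algebraMap A (Localization.AtPrime 𝔮) ∘ t) t'') (fun k => by
            induction k using Fin.addCases with
            | left k => rw [Fin.append_left]
                        exact (mem_maximalIdeal _).2 (map_nonunit (algebraMap A _) _
                          ((mem_maximalIdeal _).1 (ht k)))
            | right k => rw [Fin.append_right]; exact ht'' k))
        (absorbMap_zero (d := d + h) hc0) (absorbMap_ne_zero hc))) := by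
  obtain ⟨hloc, h, t'', ht'', hgen₁, hdim₁⟩ := localization_mvPolynomial_baseChange 𝔮 h𝔮
  haveI := hloc
  exact ⟨h, t'', ht'', hloc, isRegularLocalRing_localization_closedPoint_baseChange
    (algebraMap A (Localization.AtPrime 𝔮)) hP hφ0 hφadd hφm ht hgen hdim hu0 hu ht'' hgen₁ hdim₁
    hc0 hadd hc hfin⟩

end LogRegularCompleteStructure

end Literature.AlgebraicGeometry.Resolution
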